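import Literature.Claims.NS.Lindgren2012
import Literature.Analysis.FluidPDE.GavrilovAnsatz
import Literature.Analysis.FluidPDE.VorticityCalculus
import Literature.Analysis.FluidPDE.NSLerayHopfSereginEnergyProofs
import Mathlib.Analysis.SpecialFunctions.SmoothTransition
import Mathlib.MeasureTheory.Measure.Haar.InnerProductSpace

/-!
# C32 `Lindgren2012` — witness calculus for the refutation of Step 4 ((26), print p.3)

J. Lindgren, *Regular solutions of the Navier–Stokes equations in ℝ³*, arXiv 1207.1090 v3 (2012),
(26), TeX l.157–161, print p.3: from `dE/dt = 2∫⟨ω, (∇×ω) × u_⊥⟩ + 2ν∫⟨ω, Δω⟩` the text infers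
«it must be so that the integral involving the perpendicular part vanishes», typed (p479581) as
`Literature.Claims.NS.Lindgren2012.Step4_VanishingIntegral_kinematic : ∀ v, IsDatum v →
stretchPerp v = 0` and, on the solution path, `Step4_VanishingIntegral`. This file builds the
countermodel: the smooth, compactly supported, divergence-free field
`v(x) = χ(Q x) · (x₂ − x₁, (x₀ − x₂)/4, (x₁ − x₀)/9)`, `Q x = x₀² + 4x₁² + 9x₂²`,
`χ(s) = Real.smoothTransition (2 − s)` (the linear factor is `K⁻¹((1,1,1) × x)`, `K = diag(1,4,9)`,
tangent to the ellipsoids `Q = const` and trace free); it computes `ω = curl v` and `∇ × ω` in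
closed form (`curl_wit`, `curl_Om`), the stretching integrand
`⟪ω, (∇×ω) × v⟫ = χ(Q)χ'(Q)² P₁ + χ(Q)²χ'(Q) P₂` (`inner_curl_cross_ccurl_wit`; the `χ''` terms
cancel), proves `IsDatum v` (`isDatum_wit`) and rewrites `stretch v` as a Lebesgue integral over
`Fin 3 → ℝ` (`stretch_wit_eq_integral`). The sign of that integral, `−(20/81)·M < 0` with
`M = ∫ χ(|y|²)χ'(|y|²)² y₀²y₁² dy > 0`, and the two `¬ Step4…` theorems are in
`SoloRefuteLindgren2012.lean`. Anisotropy is essential: with a radial cutoff (`K = I`) the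
stretching integral of every field `χ(|x|²)·(Ax)` vanishes by symmetry.

WHAT THIS IS NOT: not a claim about NS regularity or blow-up; not a claim about any author beyond
the typed locator.
-/

set_option linter.dupNamespace false

noncomputable section

open Set Filter Function WithLp MeasureTheory
open scoped Topology RealInnerProductSpace ContDiff
open Literature.Analysis.FluidPDE
open Literature.Analysis.FluidPDE.Gavrilov.AnsatzData (fderiv_apply_comp hasFDerivAt_coord
  divergence_eq_sum)
open Literature.Claims.NS.Lindgren2012

namespace Summit.NavierStokesRegularity.NavierStokesRegularity.Theorems.Lindgren2012

/-- The cutoff profile `χ(s) = smoothTransition (2 - s)`: equal to `1` for `s ≤ 1`, to `0` for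
`s ≥ 2`, smooth, with values in `[0, 1]`. [folklore] -/
def chi (s : ℝ) : ℝ := Real.smoothTransition (2 - s)

/-- `χ'`. [folklore] -/
def chi₁ (s : ℝ) : ℝ := deriv chi s

/-- `χ''`. [folklore] -/
def chi₂ (s : ℝ) : ℝ := deriv chi₁ s

/-- `χ` is smooth. [folklore] -/
theorem chi_contDiff : ContDiff ℝ ∞ chi :=
  (Real.smoothTransition.contDiff (n := ⊤)).comp (contDiff_const.sub contDiff_id)

/-- `χ'` is smooth. [folklore] -/
theorem chi₁_contDiff : ContDiff ℝ ∞ chi₁ := by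
  have h := contDiff_infty_iff_deriv.mp chi_contDiff
  exact h.2

/-- `χ' = dχ`. [folklore] -/
theorem chi_hasDerivAt (s : ℝ) : HasDerivAt chi (chi₁ s) s :=
  ((chi_contDiff.differentiable (by simp)) s).hasDerivAt

/-- `χ'' = dχ'`. [folklore] -/
theorem chi₁_hasDerivAt (s : ℝ) : HasDerivAt chi₁ (chi₂ s) s :=
  ((chi₁_contDiff.differentiable (by simp)) s).hasDerivAt

/-- `χ` vanishes on `[2, ∞)`. [folklore] -/
theorem chi_eq_zero {s : ℝ} (hs : 2 ≤ s) : chi s = 0 :=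
  Real.smoothTransition.zero_of_nonpos (by linarith)

/-- `χ = 1` on `(-∞, 1]`. [folklore] -/
theorem chi_eq_one {s : ℝ} (hs : s ≤ 1) : chi s = 1 :=
  Real.smoothTransition.one_of_one_le (by linarith)

/-- `χ ≥ 0`. [folklore] -/
theorem chi_nonneg (s : ℝ) : 0 ≤ chi s := Real.smoothTransition.nonneg _

/-- `χ > 0` on `(-∞, 2)`. [folklore] -/
theorem chi_pos {s : ℝ} (hs : s < 2) : 0 < chi s :=
  Real.smoothTransition.pos_of_pos (by linarith)

/-- The anisotropic quadratic form `Q(x) = x₀² + 4x₁² + 9x₂²`. [folklore] -/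
def Qf (x : E3) : ℝ := x 0 ^ 2 + 4 * x 1 ^ 2 + 9 * x 2 ^ 2

/-- The witness `v(x) = χ(Q x) · K⁻¹((1,1,1) × x)`, `K = diag(1,4,9)`: a smooth compactly supported
divergence-free field (the linear field is tangent to the level sets of `Q` and trace-free).
[folklore] -/
def wit (x : E3) : E3 :=
  toLp 2 ![chi (Qf x) * (x 2 - x 1), chi (Qf x) * ((x 0 - x 2) / 4),
    chi (Qf x) * ((x 1 - x 0) / 9)]

/-- Coordinate covectors. [folklore] -/
abbrev dx (j : Fin 3) : E3 →L[ℝ] ℝ := EuclideanSpace.proj j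

/-- `DQ(x) = 2x₀ dx₀ + 8x₁ dx₁ + 18x₂ dx₂`. [folklore] -/
def dQ (x : E3) : E3 →L[ℝ] ℝ := (2 * x 0) • dx 0 + (8 * x 1) • dx 1 + (18 * x 2) • dx 2

/-- `DQ`. [folklore] -/
theorem hasFDerivAt_Qf (x : E3) : HasFDerivAt Qf (dQ x) x := by
  have h0 := hasFDerivAt_coord 0 x
  have h1 := hasFDerivAt_coord 1 x
  have h2 := hasFDerivAt_coord 2 x
  have e : Qf = fun y : E3 => y 0 * y 0 + 4 * (y 1 * y 1) + 9 * (y 2 * y 2) :=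
    funext fun y => by simp only [Qf]; ring
  rw [e]
  refine (((h0.mul h0).add ((h1.mul h1).const_mul 4)).add ((h2.mul h2).const_mul 9)).congr_fderiv ?_
  ext v
  simp [dQ, smul_eq_mul]
  ring

/-- `D(χ ∘ Q)(x) = χ'(Q x) DQ(x)`. [folklore] -/
theorem hasFDerivAt_chiQ (x : E3) :
    HasFDerivAt (fun y => chi (Qf y)) (chi₁ (Qf x) • dQ x) x :=
  (chi_hasDerivAt (Qf x)).comp_hasFDerivAt x (hasFDerivAt_Qf x)

/-- `D(χ' ∘ Q)(x) = χ''(Q x) DQ(x)`. [folklore] -/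
theorem hasFDerivAt_chi₁Q (x : E3) :
    HasFDerivAt (fun y => chi₁ (Qf y)) (chi₂ (Qf x) • dQ x) x :=
  (chi₁_hasDerivAt (Qf x)).comp_hasFDerivAt x (hasFDerivAt_Qf x)

/-- A function that agrees with a continuous linear map has it as derivative. [folklore] -/
theorem hasFDerivAt_of_eq_clm {f : E3 → ℝ} (L : E3 →L[ℝ] ℝ) (x : E3) (h : ∀ y, f y = L y) :
    HasFDerivAt f L x :=
  L.hasFDerivAt.congr_of_eventuallyEq (Eventually.of_forall h)

/-- `Dv₀`. [folklore] -/
theorem hasFDerivAt_wit_zero (x : E3) :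
    HasFDerivAt (fun y => wit y 0)
      (chi (Qf x) • (dx 2 - dx 1) + (x 2 - x 1) • (chi₁ (Qf x) • dQ x)) x := by
  have h : HasFDerivAt (fun y : E3 => chi (Qf y) * (y 2 - y 1))
      (chi (Qf x) • (dx 2 - dx 1) + (x 2 - x 1) • (chi₁ (Qf x) • dQ x)) x :=
    (hasFDerivAt_chiQ x).mul (hasFDerivAt_of_eq_clm (f := fun y : E3 => y 2 - y 1) _ x
      (fun y => by simp))
  exact h

/-- `Dv₁`. [folklore] -/
theorem hasFDerivAt_wit_one (x : E3) :
    HasFDerivAt (fun y => wit y 1)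
      (chi (Qf x) • ((1 / 4 : ℝ) • (dx 0 - dx 2))
        + ((x 0 - x 2) / 4) • (chi₁ (Qf x) • dQ x)) x := by
  have h : HasFDerivAt (fun y : E3 => chi (Qf y) * ((y 0 - y 2) / 4))
      (chi (Qf x) • ((1 / 4 : ℝ) • (dx 0 - dx 2))
        + ((x 0 - x 2) / 4) • (chi₁ (Qf x) • dQ x)) x :=
    (hasFDerivAt_chiQ x).mul (hasFDerivAt_of_eq_clm (f := fun y : E3 => (y 0 - y 2) / 4) _ x
      (fun y => by simp [smul_eq_mul]; ring))
  exact h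

/-- `Dv₂`. [folklore] -/
theorem hasFDerivAt_wit_two (x : E3) :
    HasFDerivAt (fun y => wit y 2)
      (chi (Qf x) • ((1 / 9 : ℝ) • (dx 1 - dx 0))
        + ((x 1 - x 0) / 9) • (chi₁ (Qf x) • dQ x)) x := by
  have h : HasFDerivAt (fun y : E3 => chi (Qf y) * ((y 1 - y 0) / 9))
      (chi (Qf x) • ((1 / 9 : ℝ) • (dx 1 - dx 0))
        + ((x 1 - x 0) / 9) • (chi₁ (Qf x) • dQ x)) x :=
    (hasFDerivAt_chiQ x).mul (hasFDerivAt_of_eq_clm (f := fun y : E3 => (y 1 - y 0) / 9) _ x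
      (fun y => by simp [smul_eq_mul]; ring))
  exact h

/-- `v` is differentiable. [folklore] -/
theorem differentiableAt_wit (x : E3) : DifferentiableAt ℝ wit x := by
  rw [differentiableAt_euclidean]
  intro i
  fin_cases i
  · exact (hasFDerivAt_wit_zero x).differentiableAt
  · exact (hasFDerivAt_wit_one x).differentiableAt
  · exact (hasFDerivAt_wit_two x).differentiableAt

/-- Closed form of `ω = curl v`. [folklore] -/
def Om (x : E3) : E3 :=
  toLp 2 ![(13 / 36) * chi (Qf x) + chi₁ (Qf x) * ((9 / 2) * x 2 ^ 2 + (8 / 9) * x 1 ^ 2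
      - (9 / 2) * x 0 * x 2 - (8 / 9) * x 0 * x 1),
    (10 / 9) * chi (Qf x) + chi₁ (Qf x) * (18 * x 2 ^ 2 - 18 * x 1 * x 2 - (2 / 9) * x 0 * x 1
      + (2 / 9) * x 0 ^ 2),
    (5 / 4) * chi (Qf x) + chi₁ (Qf x) * (-8 * x 1 * x 2 + 8 * x 1 ^ 2 - (1 / 2) * x 0 * x 2
      + (1 / 2) * x 0 ^ 2)]

/-- `curl v = ω` in closed form. [folklore] -/
theorem curl_wit : curl wit = Om := by
  funext x
  have hd := differentiableAt_wit x
  simp only [curl]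
  ext i
  fin_cases i <;>
    simp only [fderiv_apply_comp hd, (hasFDerivAt_wit_zero x).fderiv,
      (hasFDerivAt_wit_one x).fderiv, (hasFDerivAt_wit_two x).fderiv] <;>
    simp [Om, dQ, smul_eq_mul] <;> ring

/-- `Dω₀`. [folklore] -/
theorem hasFDerivAt_Om_zero (x : E3) :
    HasFDerivAt (fun y => Om y 0)
      ((13 / 36 : ℝ) • (chi₁ (Qf x) • dQ x) +
        (chi₁ (Qf x) • ((-(9 / 2) * x 2 - (8 / 9) * x 1) • dx 0
            + ((16 / 9) * x 1 - (8 / 9) * x 0) • dx 1 + (9 * x 2 - (9 / 2) * x 0) • dx 2) +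
          ((9 / 2) * x 2 ^ 2 + (8 / 9) * x 1 ^ 2 - (9 / 2) * x 0 * x 2 - (8 / 9) * x 0 * x 1) •
            (chi₂ (Qf x) • dQ x))) x := by
  have h0 := hasFDerivAt_coord 0 x
  have h1 := hasFDerivAt_coord 1 x
  have h2 := hasFDerivAt_coord 2 x
  have hp : HasFDerivAt
      (fun y : E3 =>
        (9 / 2) * y 2 ^ 2 + (8 / 9) * y 1 ^ 2 - (9 / 2) * y 0 * y 2 - (8 / 9) * y 0 * y 1)
      ((-(9 / 2) * x 2 - (8 / 9) * x 1) • dx 0 + ((16 / 9) * x 1 - (8 / 9) * x 0) • dx 1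
        + (9 * x 2 - (9 / 2) * x 0) • dx 2) x := by
    refine (((((h2.pow 2).const_mul (9 / 2 : ℝ)).add ((h1.pow 2).const_mul (8 / 9 : ℝ))).sub
      ((h0.const_mul (9 / 2 : ℝ)).mul h2)).sub ((h0.const_mul (8 / 9 : ℝ)).mul h1)).congr_fderiv ?_
    ext v
    simp [smul_eq_mul]
    ring
  have h : HasFDerivAt (fun y : E3 => (13 / 36) * chi (Qf y) + chi₁ (Qf y) *
      ((9 / 2) * y 2 ^ 2 + (8 / 9) * y 1 ^ 2 - (9 / 2) * y 0 * y 2 - (8 / 9) * y 0 * y 1)) _ x :=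
    ((hasFDerivAt_chiQ x).const_mul (13 / 36 : ℝ)).add ((hasFDerivAt_chi₁Q x).mul hp)
  exact h

/-- `Dω₁`. [folklore] -/
theorem hasFDerivAt_Om_one (x : E3) :
    HasFDerivAt (fun y => Om y 1)
      ((10 / 9 : ℝ) • (chi₁ (Qf x) • dQ x) +
        (chi₁ (Qf x) • ((-(2 / 9) * x 1 + (4 / 9) * x 0) • dx 0 + (-18 * x 2 - (2 / 9) * x 0) • dx 1
            + (36 * x 2 - 18 * x 1) • dx 2) +
          (18 * x 2 ^ 2 - 18 * x 1 * x 2 - (2 / 9) * x 0 * x 1 + (2 / 9) * x 0 ^ 2) •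
            (chi₂ (Qf x) • dQ x))) x := by
  have h0 := hasFDerivAt_coord 0 x
  have h1 := hasFDerivAt_coord 1 x
  have h2 := hasFDerivAt_coord 2 x
  have hp : HasFDerivAt
      (fun y : E3 => 18 * y 2 ^ 2 - 18 * y 1 * y 2 - (2 / 9) * y 0 * y 1 + (2 / 9) * y 0 ^ 2)
      ((-(2 / 9) * x 1 + (4 / 9) * x 0) • dx 0 + (-18 * x 2 - (2 / 9) * x 0) • dx 1
        + (36 * x 2 - 18 * x 1) • dx 2) x := by
    refine (((((h2.pow 2).const_mul (18 : ℝ)).sub ((h1.const_mul (18 : ℝ)).mul h2)).sub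
      ((h0.const_mul (2 / 9 : ℝ)).mul h1)).add ((h0.pow 2).const_mul (2 / 9 : ℝ))).congr_fderiv ?_
    ext v
    simp [smul_eq_mul]
    ring
  have h : HasFDerivAt (fun y : E3 => (10 / 9) * chi (Qf y) + chi₁ (Qf y) *
      (18 * y 2 ^ 2 - 18 * y 1 * y 2 - (2 / 9) * y 0 * y 1 + (2 / 9) * y 0 ^ 2)) _ x :=
    ((hasFDerivAt_chiQ x).const_mul (10 / 9 : ℝ)).add ((hasFDerivAt_chi₁Q x).mul hp)
  exact h

/-- `Dω₂`. [folklore] -/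
theorem hasFDerivAt_Om_two (x : E3) :
    HasFDerivAt (fun y => Om y 2)
      ((5 / 4 : ℝ) • (chi₁ (Qf x) • dQ x) +
        (chi₁ (Qf x) • ((-(1 / 2) * x 2 + x 0) • dx 0 + (-8 * x 2 + 16 * x 1) • dx 1
            + (-8 * x 1 - (1 / 2) * x 0) • dx 2) +
          (-8 * x 1 * x 2 + 8 * x 1 ^ 2 - (1 / 2) * x 0 * x 2 + (1 / 2) * x 0 ^ 2) •
            (chi₂ (Qf x) • dQ x))) x := by
  have h0 := hasFDerivAt_coord 0 x
  have h1 := hasFDerivAt_coord 1 x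
  have h2 := hasFDerivAt_coord 2 x
  have hp : HasFDerivAt
      (fun y : E3 => -8 * y 1 * y 2 + 8 * y 1 ^ 2 - (1 / 2) * y 0 * y 2 + (1 / 2) * y 0 ^ 2)
      ((-(1 / 2) * x 2 + x 0) • dx 0 + (-8 * x 2 + 16 * x 1) • dx 1
        + (-8 * x 1 - (1 / 2) * x 0) • dx 2) x := by
    refine (((((h1.const_mul (-8 : ℝ)).mul h2).add ((h1.pow 2).const_mul (8 : ℝ))).sub
      ((h0.const_mul (1 / 2 : ℝ)).mul h2)).add ((h0.pow 2).const_mul (1 / 2 : ℝ))).congr_fderiv ?_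
    ext v
    simp [smul_eq_mul]
    ring
  have h : HasFDerivAt (fun y : E3 => (5 / 4) * chi (Qf y) + chi₁ (Qf y) *
      (-8 * y 1 * y 2 + 8 * y 1 ^ 2 - (1 / 2) * y 0 * y 2 + (1 / 2) * y 0 ^ 2)) _ x :=
    ((hasFDerivAt_chiQ x).const_mul (5 / 4 : ℝ)).add ((hasFDerivAt_chi₁Q x).mul hp)
  exact h

/-- `ω` is differentiable. [folklore] -/
theorem differentiableAt_Om (x : E3) : DifferentiableAt ℝ Om x := by
  rw [differentiableAt_euclidean]
  intro i
  fin_cases i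
  · exact (hasFDerivAt_Om_zero x).differentiableAt
  · exact (hasFDerivAt_Om_one x).differentiableAt
  · exact (hasFDerivAt_Om_two x).differentiableAt

/-- Closed form of `∇ × ω = curl (curl v)`. [folklore] -/
def COm (x : E3) : E3 :=
  toLp 2 ![chi₁ (Qf x) * (-64 * x 2 + 44 * x 1) + chi₂ (Qf x) * (-324 * x 2 ^ 3
      + 324 * x 1 * x 2 ^ 2 - 64 * x 1 ^ 2 * x 2 + 64 * x 1 ^ 3 - 4 * x 0 ^ 2 * x 2
      + 4 * x 0 ^ 2 * x 1),
    chi₁ (Qf x) * (16 * x 2 - 8 * x 0) + chi₂ (Qf x) * (81 * x 2 ^ 3 + 16 * x 1 ^ 2 * x 2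
      - 81 * x 0 * x 2 ^ 2 - 16 * x 0 * x 1 ^ 2 + x 0 ^ 2 * x 2 - x 0 ^ 3),
    chi₁ (Qf x) * (-(44 / 9) * x 1 + (32 / 9) * x 0) + chi₂ (Qf x) * (-36 * x 1 * x 2 ^ 2
      - (64 / 9) * x 1 ^ 3 + 36 * x 0 * x 2 ^ 2 + (64 / 9) * x 0 * x 1 ^ 2 - (4 / 9) * x 0 ^ 2 * x 1
      + (4 / 9) * x 0 ^ 3)]

/-- `curl ω = ∇ × ω` in closed form. [folklore] -/
theorem curl_Om : curl Om = COm := by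
  funext x
  have hd := differentiableAt_Om x
  simp only [curl]
  ext i
  fin_cases i <;>
    simp only [fderiv_apply_comp hd, (hasFDerivAt_Om_zero x).fderiv,
      (hasFDerivAt_Om_one x).fderiv, (hasFDerivAt_Om_two x).fderiv] <;>
    simp [COm, dQ, smul_eq_mul] <;> ring

/-- `∇ × ω` of the witness. [folklore] -/
theorem ccurl_wit (x : E3) : ccurl wit x = COm x := by
  rw [ccurl, curl_wit, curl_Om]

/-- The two polynomial factors `P₁` (weight `χχ'²`) and `P₂` (weight `χ²χ'`) of the integrand,
as functions of the three coordinates. [folklore] -/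
def P₁ (a b c : ℝ) : ℝ :=
  (85 / 2) * b * c ^ 3 - 80 * b ^ 2 * c ^ 2 + (3280 / 81) * b ^ 3 * c - 68 * a * c ^ 3
    + (297 / 2) * a * b * c ^ 2 - (1024 / 9) * a * b ^ 2 * c + (656 / 27) * a * b ^ 3
    + 8 * a ^ 2 * c ^ 2 + (85 / 54) * a ^ 2 * b * c - (16 / 27) * a ^ 2 * b ^ 2
    - (388 / 81) * a ^ 3 * c + (97 / 54) * a ^ 3 * b

/-- See `P₁`. [folklore] -/
def P₂ (a b c : ℝ) : ℝ := (1445 / 162) * b * c - (1156 / 81) * a * c + (289 / 54) * a * b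

/-- The integrand `⟪ω, (∇ × ω) × v⟫` as a function of `q = Q(x)` and the coordinates. [folklore] -/
def integrandF (q a b c : ℝ) : ℝ :=
  chi q * chi₁ q ^ 2 * P₁ a b c + chi q ^ 2 * chi₁ q * P₂ a b c

/-- **The vortex-stretching integrand of the witness in closed form**: the `χ''` terms cancel and
`⟪ω, (∇ × ω) × v⟫ (x) = χ(Q)χ'(Q)² P₁(x) + χ(Q)²χ'(Q) P₂(x)`. [folklore] -/
theorem inner_curl_cross_ccurl_wit (x : E3) :
    ⟪curl wit x, cross (ccurl wit x) (wit x)⟫ = integrandF (Qf x) (x 0) (x 1) (x 2) := by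
  rw [ccurl_wit, curl_wit]
  simp [Om, COm, wit, cross, cross_apply, PiLp.inner_apply, Fin.sum_univ_three, integrandF, P₁, P₂]
  ring

/-- The coordinate functions are smooth. [folklore] -/
theorem contDiff_coord (i : Fin 3) : ContDiff ℝ ∞ fun x : E3 => x i :=
  (EuclideanSpace.proj i : E3 →L[ℝ] ℝ).contDiff

/-- `Q` is smooth. [folklore] -/
theorem contDiff_Qf : ContDiff ℝ ∞ Qf :=
  (((contDiff_coord 0).pow 2).add (contDiff_const.mul ((contDiff_coord 1).pow 2))).add
    (contDiff_const.mul ((contDiff_coord 2).pow 2))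

/-- The witness is smooth. [folklore] -/
theorem contDiff_wit : ContDiff ℝ ∞ wit := by
  rw [contDiff_euclidean]
  intro i
  fin_cases i
  · exact (chi_contDiff.comp contDiff_Qf).mul ((contDiff_coord 2).sub (contDiff_coord 1))
  · exact (chi_contDiff.comp contDiff_Qf).mul
      (((contDiff_coord 0).sub (contDiff_coord 2)).div_const 4)
  · exact (chi_contDiff.comp contDiff_Qf).mul
      (((contDiff_coord 1).sub (contDiff_coord 0)).div_const 9)

/-- The witness is divergence free: the linear field is tangent to the level sets of `Q`
(`DQ · K⁻¹(n × x) = 2⟨x, n × x⟩ = 0`) and trace free. [folklore] -/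
theorem isDivFree_wit : VectorCalculus.IsDivFree wit := by
  intro x
  rw [divergence_eq_sum (differentiableAt_wit x), Fin.sum_univ_three,
    (hasFDerivAt_wit_zero x).fderiv, (hasFDerivAt_wit_one x).fderiv, (hasFDerivAt_wit_two x).fderiv]
  simp [dQ, smul_eq_mul]
  ring

/-- `|x|² ≤ Q(x)`. [folklore] -/
theorem norm_sq_le_Qf (x : E3) : ‖x‖ ^ 2 ≤ Qf x := by
  rw [EuclideanSpace.real_norm_sq_eq, Fin.sum_univ_three, Qf]
  nlinarith [sq_nonneg (x 1), sq_nonneg (x 2)]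

/-- The witness vanishes where `Q ≥ 2`. [folklore] -/
theorem wit_eq_zero {x : E3} (hx : 2 ≤ Qf x) : wit x = 0 := by
  ext i
  fin_cases i <;> simp [wit, chi_eq_zero hx]

/-- The witness is supported in the closed ball of radius `2`. [folklore] -/
theorem hasCompactSupport_wit : HasCompactSupport wit := by
  refine HasCompactSupport.intro (isCompact_closedBall (0 : E3) 2) fun x hx => wit_eq_zero ?_
  rw [Metric.mem_closedBall, dist_zero_right, not_le] at hx
  nlinarith [norm_sq_le_Qf x, norm_nonneg x]

/-- **The witness is a datum of the typed class** (`C^∞`, divergence free, all `Hⁿ` norms finite).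
[folklore] -/
theorem isDatum_wit : Literature.Claims.NS.Ruzmaikina2008.IsDatum wit :=
  ⟨contDiff_wit, isDivFree_wit, fun n =>
    (HasRapidSpatialDecay.of_hasCompactSupport contDiff_wit
      hasCompactSupport_wit).lintegral_enorm_iteratedFDeriv_sq_lt_top n⟩

/-- **The stretching integral of the witness in coordinates**:
`∫ ⟪ω, (∇ × ω) × v⟫ = ∫_{ℝ³} F(Q(y), y₀, y₁, y₂) dy` over `Fin 3 → ℝ` with Lebesgue measure.
[folklore] -/
theorem stretch_wit_eq_integral :
    stretch wit =
      ∫ y : Fin 3 → ℝ, integrandF (y 0 ^ 2 + 4 * y 1 ^ 2 + 9 * y 2 ^ 2) (y 0) (y 1) (y 2) := by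
  have hmp : MeasurePreserving (MeasurableEquiv.toLp 2 (Fin 3 → ℝ)) volume volume :=
    (EuclideanSpace.volume_preserving_symm_measurableEquiv_toLp (Fin 3)).symm
  rw [stretch, ← hmp.integral_comp']
  refine integral_congr_ae (Eventually.of_forall fun y => ?_)
  simp only [MeasurableEquiv.coe_toLp, inner_curl_cross_ccurl_wit]
  rfl

end Summit.NavierStokesRegularity.NavierStokesRegularity.Theorems.Lindgren2012

end
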